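import Summits.QuantumFields.YangMills.Theorems.BalabanUVNodesN15PerCubeGreenDictionary
import Summits.QuantumFields.YangMills.Theorems.BalabanUVNodesN15TwoSpacingGluingSopLocality
import HarnessLib

/-!
# N15 = NE2, road (c) — PROGRAMME (PC), towards (PC-B): letters for the site coarse kit — the staircase transports of a `U(m)` field are ORTHOGONAL (entries `≤ 1`, rows and
# columns `≤ |ι|`), block-diagonal kernels in n15-c∕297's exponential currency, and `Q′(T) − Q′(𝟙)` rows with a SITE-DEPENDENT letter (dag-n15-c g27, n15-c∕298a)

Cell `pub-ymgap`, seat `pub-ymgap-dag-n15-c` (generation g27; R134 (a), s1; HUMAN RULING D-0062).  `bears_on: R4∕N15 · K3⁸ SpineGivenEndpointR13SepCoPHV (stmt-QuantumFields-27366)`;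
filed `--kind proof --supports stmt-QuantumFields-27366 --as helper` — COUNT-NEUTRAL.  0 `def`, 0 `sorry`.  Imports n15-c∕266 `…PerCubeGreenDictionary` (through it: n15-c∕181∕185
`cvaStair`, `cvaStair_conj`, `holStair_unitary`; dag-n15-w2 `uN_coordMat_conj_orthogonal`; `abs_entry_le_one_of_orthogonal`; `cvT`) and n15-c∕297 `…TwoSpacingGluingSopLocality` (the
currency of `hasMaj_sop_sub_sop`).  Nothing in the tree is modified.

WHY.  n15-c∕297's coarse kit asks for the rows of `Q′(T)`, `Q′(T)ᵀ` (`τe^{−δd}`) and of their differences; n15-c∕202∕205 (`hasMaj_csavg`, `hasMaj_csavg_transpose`) turn STAIRCASE letters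
into block-diagonal kernels `𝟙[w = w′]·τ`.  §1 supplies the staircase letters of `T = cvT e U` for EVERY unitary `U` (no smallness: the transports are orthogonal), §2 turns block-diagonal
kernels into the exponential currency (`d(w,w) = 0`), with a constant or a site-dependent letter.

HONEST FRAMING ∕ LIMITS.  Elementary; MODEL carriers; nothing of record touched; NE2⁺ NOT PRINTED, NOT proved; K3⁸ OPEN; counts UNMOVED.  Restate-immune (no Theses import).
-/

set_option autoImplicit false

noncomputable section
open scoped BigOperators Matrix
open Finset

namespace Summit.QuantumFields.YangMills.BalabanUVNodes.N15.Gluing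

open Literature.MathematicalPhysics.QuantumFieldTheory.Balaban1983to89
open Literature.MathematicalPhysics.QuantumFieldTheory.Balaban1983to89.B5Prop11Plancherel (Tor fine)
open Literature.MathematicalPhysics.QuantumFieldTheory.Balaban1983to89.B11SectG (BlockNorm HasMaj)
open Literature.Barriers.QuantumFields (traceForm)
open Summit.QuantumFields.YangMills.BalabanUVNodes.N15.MatrixSpecies (coordMat)
open Summit.QuantumFields.YangMills.BalabanUVNodes.N15.CovAvg (cvaStair cvaStair_conj holStair holStair_unitary)
open Summit.QuantumFields.YangMills.BalabanUVNodes.N15.CurvedSpecies (uN_coordMat_conj_orthogonal abs_entry_le_one_of_orthogonal)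

/-! ## §1 The staircase transports of a unitary field: entries `≤ 1`, rows and columns `≤ |ι|` -/

section Stair

variable {d : ℕ} (M : Fin (d + 1) → ℕ) [∀ μ, NeZero (M μ)] (n : ℕ) [NeZero n] {ι : Type} [Fintype ι] [DecidableEq ι] {mm : Type} [Fintype mm] [DecidableEq mm]
  (e : Matrix mm mm ℂ ≃L[ℝ] (ι → ℝ))

omit [∀ μ, NeZero (M μ)] in
/-- ★ the staircase transport `T(Γ_{y,a})` of `T = cvT e U`, `U` unitary, is an orthogonal matrix (n15-c∕185 `cvaStair_conj`: it is `coordMat e Ad_{hol}` with `hol` the unitary staircase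
holonomy; dag-n15-w2 `uN_coordMat_conj_orthogonal`). [cite: Balaban1985Averaging, (125)–(126) p.36 («|(Q₀A)_c| ≤ |A|»: shape)] -/
theorem cvaStair_cvT_orthogonal (he : ∀ A B : Matrix mm mm ℂ, traceForm A B = e A ⬝ᵥ e B) {U : Fin (d + 1) → Tor (fine n M) → Matrix mm mm ℂ} (hU : ∀ μ x, (U μ x)ᴴ * U μ x = 1)
    (y : Tor M) (a : Fin (d + 1) → Fin n) (ν : Fin (d + 1)) :
    (cvaStair M n (fun μ b => cvT e U μ b.1) y a ν)ᵀ * cvaStair M n (fun μ b => cvT e U μ b.1) y a ν = 1 ∧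
      cvaStair M n (fun μ b => cvT e U μ b.1) y a ν * (cvaStair M n (fun μ b => cvT e U μ b.1) y a ν)ᵀ = 1 := by
  have h := cvaStair_conj M n e (fun μ (q : Tor (fine n M) × Fin (d + 1)) => U μ q.1) y a ν
  change cvaStair M n (fun μ b => cvT e U μ b.1) y a ν = _ at h
  rw [h]
  exact uN_coordMat_conj_orthogonal e he (holStair_unitary M (fun μ p => hU μ p.1) y a ν)

omit [∀ μ, NeZero (M μ)] in
/-- entries of the staircase transport of a unitary field are `≤ 1` in absolute value. [folklore] -/
theorem abs_cvaStair_cvT_le_one (he : ∀ A B : Matrix mm mm ℂ, traceForm A B = e A ⬝ᵥ e B) {U : Fin (d + 1) → Tor (fine n M) → Matrix mm mm ℂ} (hU : ∀ μ x, (U μ x)ᴴ * U μ x = 1)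
    (y : Tor M) (a : Fin (d + 1) → Fin n) (ν : Fin (d + 1)) (i j : ι) :
    |cvaStair M n (fun μ b => cvT e U μ b.1) y a ν i j| ≤ 1 :=
  abs_entry_le_one_of_orthogonal (cvaStair_cvT_orthogonal M n e he hU y a ν).2 i j

omit [∀ μ, NeZero (M μ)] in
/-- ★ ROW letter of the staircase transports of a unitary field: `Σ_j |T(Γ)_{ij}| ≤ |ι|`. [folklore] -/
theorem rows_cvaStair_cvT_le (he : ∀ A B : Matrix mm mm ℂ, traceForm A B = e A ⬝ᵥ e B) {U : Fin (d + 1) → Tor (fine n M) → Matrix mm mm ℂ} (hU : ∀ μ x, (U μ x)ᴴ * U μ x = 1)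
    (y : Tor M) (a : Fin (d + 1) → Fin n) (ν : Fin (d + 1)) (i : ι) :
    ∑ j, |cvaStair M n (fun μ b => cvT e U μ b.1) y a ν i j| ≤ Fintype.card ι := by
  calc ∑ j, |cvaStair M n (fun μ b => cvT e U μ b.1) y a ν i j| ≤ ∑ _j : ι, (1 : ℝ) := Finset.sum_le_sum fun j _ => abs_cvaStair_cvT_le_one M n e he hU y a ν i j
    _ = Fintype.card ι := by rw [Finset.sum_const, Finset.card_univ, nsmul_eq_mul, mul_one]

omit [∀ μ, NeZero (M μ)] in
/-- ★ COLUMN letter of the staircase transports of a unitary field: `Σ_i |T(Γ)_{ij}| ≤ |ι|`. [folklore] -/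
theorem cols_cvaStair_cvT_le (he : ∀ A B : Matrix mm mm ℂ, traceForm A B = e A ⬝ᵥ e B) {U : Fin (d + 1) → Tor (fine n M) → Matrix mm mm ℂ} (hU : ∀ μ x, (U μ x)ᴴ * U μ x = 1)
    (y : Tor M) (a : Fin (d + 1) → Fin n) (ν : Fin (d + 1)) (j : ι) :
    ∑ i, |cvaStair M n (fun μ b => cvT e U μ b.1) y a ν i j| ≤ Fintype.card ι := by
  calc ∑ i, |cvaStair M n (fun μ b => cvT e U μ b.1) y a ν i j| ≤ ∑ _i : ι, (1 : ℝ) := Finset.sum_le_sum fun i _ => abs_cvaStair_cvT_le_one M n e he hU y a ν i j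
    _ = Fintype.card ι := by rw [Finset.sum_const, Finset.card_univ, nsmul_eq_mul, mul_one]

end Stair

/-! ## §2 Block-diagonal kernels in the exponential currency -/

section Diag

variable {g : B6.Geometry} [DecidableEq g.Site] {F₁ F₂ : Type} [AddCommGroup F₁] [Module ℝ F₁] [AddCommGroup F₂] [Module ℝ F₂]

/-- a block-diagonal kernel with a constant letter is an exponential kernel of ANY rate: `𝟙[w = w′]·τ ≤ τ·e^{−ρd(w,w′)}` (`d(w,w) = 0`, `τ ≥ 0`). [folklore] -/
theorem HasMaj.diag_const_exp {b₁ : BlockNorm g F₁} {b₂ : BlockNorm g F₂} {T : F₁ →ₗ[ℝ] F₂} {τ : ℝ} (ρ : ℝ) (hd0 : ∀ y : g.Site, g.dist y y = 0) (hτ : 0 ≤ τ)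
    (h : HasMaj b₁ b₂ T (fun w w' => if w = w' then τ else 0)) :
    HasMaj b₁ b₂ T (fun w w' => τ * Real.exp (-(ρ * g.dist w w'))) := by
  refine h.mono fun w w' => ?_
  split_ifs with hw
  · subst hw; rw [hd0, mul_zero, neg_zero, Real.exp_zero, mul_one]
  · positivity

/-- a block-diagonal kernel with a SITE-DEPENDENT letter dominated by a near∕far weight is a weighted exponential kernel: `𝟙[w = w′]·σ(w) ≤ (s + fe^{−cd_Z(w)})·pe^{−ρd}` when
`σ(w) ≤ (s + fe^{−cd_Z(w)})·p`. [folklore] -/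
theorem HasMaj.diag_weight_exp {b₁ : BlockNorm g F₁} {b₂ : BlockNorm g F₂} {T : F₁ →ₗ[ℝ] F₂} {σf : g.Site → ℝ} (dZ : g.Site → ℝ) {s f c p : ℝ} (ρ : ℝ)
    (hd0 : ∀ y : g.Site, g.dist y y = 0) (hs : 0 ≤ s) (hf : 0 ≤ f) (hp : 0 ≤ p) (hσ : ∀ w, σf w ≤ (s + f * Real.exp (-(c * dZ w))) * p)
    (h : HasMaj b₁ b₂ T (fun w w' => if w = w' then σf w else 0)) :
    HasMaj b₁ b₂ T (fun w w' => (s + f * Real.exp (-(c * dZ w))) * (p * Real.exp (-(ρ * g.dist w w')))) := by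
  refine h.mono fun w w' => ?_
  split_ifs with hw
  · subst hw; rw [hd0, mul_zero, neg_zero, Real.exp_zero, mul_one]; exact hσ w
  · positivity

end Diag

end Summit.QuantumFields.YangMills.BalabanUVNodes.N15.Gluing

/-! ## §3 `Q′(T) − Q′(1)` and its transpose with a SITE-DEPENDENT staircase letter (n15-c∕202∕205 with `σ ↦ σ(y)`) -/

namespace Summit.QuantumFields.YangMills.BalabanUVNodes.N15.CovLandau

open Literature.MathematicalPhysics.QuantumFieldTheory.Balaban1983to89
open Literature.MathematicalPhysics.QuantumFieldTheory.Balaban1983to89.B5Prop11Plancherel (Tor fine)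
open Literature.MathematicalPhysics.QuantumFieldTheory.Balaban1983to89.B11SectG (BlockNorm HasMaj)
open Literature.MathematicalPhysics.QuantumFieldTheory.Balaban1983to89.B6UnitTorusCarrier (unitTorusGeo)
open Literature.MathematicalPhysics.QuantumFieldTheory.Balaban1983to89.T4EtaRateCoeffDefect (fibre mem_fibre)
open Literature.MathematicalPhysics.QuantumFieldTheory.King1986.Torus (blockOf)
open Summit.QuantumFields.YangMills.BalabanUVNodes.N15.VectorPiece (blockCoords blockCoords_bpt)
open Summit.QuantumFields.YangMills.BalabanUVNodes.N15.DefectKernel (kingBlockOf_bpt)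
open Summit.QuantumFields.YangMills.BalabanUVNodes.N15.MatrixSpecies (liftBlk)
open Summit.QuantumFields.YangMills.BalabanUVNodes.N15.CovAvg (cvaStair)
open Summit.QuantumFields.YangMills.BalabanUVNodes.N15.BlockRows (hasMaj_mulVecLin_of_sum_abs_le)

section LocalLetter

variable {d : ℕ} (M : Fin (d + 1) → ℕ) [∀ μ, NeZero (M μ)] (n : ℕ) [NeZero n] {ι : Type} [Fintype ι] [DecidableEq ι] (L k : ℕ)

/-- ROW SUMS of `Q′_T − Q′_{T′}` with a letter depending on the coarse site: `≤ σ(y)` at row `(y, i)` when the rows of the staircase differences of block `y` are `≤ σ(y)`. [folklore] -/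
theorem csavg_sub_rows_le_at {T T' : Fin (d + 1) → Tor (fine n M) → Matrix ι ι ℝ} {σf : Tor M → ℝ}
    (hσ : ∀ y a i, ∑ j, |(cvaStair M n (fun μ b => T μ b.1) y a 0 - cvaStair M n (fun μ b => T' μ b.1) y a 0) i j| ≤ σf y) (q : Tor M × ι) :
    ∑ p, |(csavg M n T - csavg M n T') q p| ≤ σf q.1 := by
  have hn : (0 : ℝ) < (n : ℝ) ^ (d + 1) := pow_pos (Nat.cast_pos.mpr (Nat.pos_of_ne_zero (NeZero.ne n))) _
  rw [Fintype.sum_prod_type, ← (Equiv.ofBijective _ (B5Blocks16.bpt_bijective n M)).sum_comp, Fintype.sum_prod_type]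
  simp only [Equiv.ofBijective_apply, csavg_sub_apply, kingBlockOf_bpt, blockCoords_bpt]
  rw [Finset.sum_eq_single q.1 (fun y _ hy => by simp [hy]) (fun h => (h (Finset.mem_univ _)).elim)]
  simp only [if_true, abs_mul, abs_inv, abs_pow, Nat.abs_cast, ← Finset.mul_sum]
  calc ((n : ℝ) ^ (d + 1))⁻¹ * ∑ a : Fin (d + 1) → Fin n, ∑ j, |(cvaStair M n (fun μ b => T μ b.1) q.1 a 0 - cvaStair M n (fun μ b => T' μ b.1) q.1 a 0) q.2 j|
      ≤ ((n : ℝ) ^ (d + 1))⁻¹ * ∑ _a : Fin (d + 1) → Fin n, σf q.1 := mul_le_mul_of_nonneg_left (Finset.sum_le_sum fun a _ => hσ q.1 a q.2) (inv_nonneg.mpr hn.le)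
    _ = σf q.1 := by
        rw [Finset.sum_const, Finset.card_univ, nsmul_eq_mul, Fintype.card_pi, Finset.prod_const, Fintype.card_fin, Finset.card_univ, Fintype.card_fin]
        push_cast
        rw [inv_mul_cancel_left₀ hn.ne']

/-- COLUMN SUMS of `Q′_T − Q′_{T′}` with a site-dependent letter: `≤ n^{−(d+1)}·σ(B(x))` at column `(x, j)`. [folklore] -/
theorem csavg_sub_cols_le_at {T T' : Fin (d + 1) → Tor (fine n M) → Matrix ι ι ℝ} {σf : Tor M → ℝ}
    (hσ : ∀ y a j, ∑ i, |(cvaStair M n (fun μ b => T μ b.1) y a 0 - cvaStair M n (fun μ b => T' μ b.1) y a 0) i j| ≤ σf y) (p : Tor (fine n M) × ι) :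
    ∑ q, |(csavg M n T - csavg M n T') q p| ≤ ((n : ℝ) ^ (d + 1))⁻¹ * σf (blockOf n M p.1) := by
  have hn : (0 : ℝ) < (n : ℝ) ^ (d + 1) := pow_pos (Nat.cast_pos.mpr (Nat.pos_of_ne_zero (NeZero.ne n))) _
  rw [Fintype.sum_prod_type]
  simp only [csavg_sub_apply]
  rw [Finset.sum_eq_single (blockOf n M p.1) (fun y _ hy => by simp [Ne.symm hy]) (fun h => (h (Finset.mem_univ _)).elim)]
  simp only [if_true, abs_mul, abs_inv, abs_pow, Nat.abs_cast, ← Finset.mul_sum]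
  exact mul_le_mul_of_nonneg_left (hσ _ _ p.2) (inv_nonneg.mpr hn.le)

variable [DecidableEq (Tor M)]

/-- ★ `Q′(T) − Q′(1) : BS → BC` has the block-diagonal row `𝟙[y = y′]·σ(y)` with a site-dependent staircase letter (n15-c∕202 `hasMaj_csavg_sub` with `σ ↦ σ(y)`).
[cite: Balaban1985BackgroundPropagators, Thm 3.4 p.400 (mechanism)] -/
theorem hasMaj_csavg_sub_at (T : Fin (d + 1) → Tor (fine n M) → Matrix ι ι ℝ) {σf : Tor M → ℝ} (hσ0 : ∀ y, 0 ≤ σf y)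
    (hσ : ∀ y a i, ∑ j, |(cvaStair M n (fun μ b => T μ b.1) y a 0 - cvaStair M n (fun μ b => (fun (_ : Fin (d + 1)) (_ : Tor (fine n M)) => (1 : Matrix ι ι ℝ)) μ b.1) y a 0) i j| ≤ σf y) :
    HasMaj (BlockNorm.ofBlocks (unitTorusGeo L k M) (liftBlk (blockOf n M) ι)) (BlockNorm.ofBlocks (unitTorusGeo L k M) (liftBlk (fun y : Tor M => y) ι))
      (Matrix.mulVecLin (csavg M n T - csavg M n (fun (_ : Fin (d + 1)) (_ : Tor (fine n M)) => (1 : Matrix ι ι ℝ))))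
      (fun w w' => if w = w' then σf w else 0) := by
  refine hasMaj_mulVecLin_of_sum_abs_le _ _ (fun w w' => by split_ifs <;> simp [hσ0]) fun q w' => ?_
  change ∑ p ∈ fibre (liftBlk (blockOf n M) ι) w', |(csavg M n T - csavg M n (fun (_ : Fin (d + 1)) (_ : Tor (fine n M)) => (1 : Matrix ι ι ℝ))) q p| ≤ if q.1 = w' then σf q.1 else 0
  split_ifs with hw
  · calc ∑ p ∈ fibre (liftBlk (blockOf n M) ι) w', |(csavg M n T - csavg M n (fun (_ : Fin (d + 1)) (_ : Tor (fine n M)) => (1 : Matrix ι ι ℝ))) q p|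
        ≤ ∑ p, |(csavg M n T - csavg M n (fun (_ : Fin (d + 1)) (_ : Tor (fine n M)) => (1 : Matrix ι ι ℝ))) q p| := Finset.sum_le_univ_sum_of_nonneg fun p => abs_nonneg _
      _ ≤ σf q.1 := csavg_sub_rows_le_at M n (T := T) (T' := fun (_ : Fin (d + 1)) (_ : Tor (fine n M)) => (1 : Matrix ι ι ℝ)) hσ q
  · refine le_of_eq (Finset.sum_eq_zero fun p hp => ?_)
    have hp1 : blockOf n M p.1 = w' := (mem_fibre (liftBlk (blockOf n M) ι) w' p).1 hp
    rw [csavg_sub_apply]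
    have : ¬ blockOf n M p.1 = q.1 := fun h => hw (h.symm.trans hp1)
    simp [this]

/-- ★ `(Q′(T) − Q′(1))ᵀ : BC → BS` has the block-diagonal row `𝟙[y = y′]·n^{−(d+1)}σ(y)` with a site-dependent COLUMN letter (n15-c∕205 `hasMaj_csavg_sub_transpose` with `σ ↦ σ(y)`).
[cite: Balaban1985BackgroundPropagators, Thm 3.4 p.400 (mechanism)] -/
theorem hasMaj_csavg_sub_transpose_at (T : Fin (d + 1) → Tor (fine n M) → Matrix ι ι ℝ) {σf : Tor M → ℝ} (hσ0 : ∀ y, 0 ≤ σf y)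
    (hσ : ∀ y a j, ∑ i, |(cvaStair M n (fun μ b => T μ b.1) y a 0 - cvaStair M n (fun μ b => (fun (_ : Fin (d + 1)) (_ : Tor (fine n M)) => (1 : Matrix ι ι ℝ)) μ b.1) y a 0) i j| ≤ σf y) :
    HasMaj (BlockNorm.ofBlocks (unitTorusGeo L k M) (liftBlk (fun y : Tor M => y) ι)) (BlockNorm.ofBlocks (unitTorusGeo L k M) (liftBlk (blockOf n M) ι))
      (Matrix.mulVecLin (csavg M n T - csavg M n (fun (_ : Fin (d + 1)) (_ : Tor (fine n M)) => (1 : Matrix ι ι ℝ)))ᵀ)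
      (fun w w' => if w = w' then ((n : ℝ) ^ (d + 1))⁻¹ * σf w else 0) := by
  have hn : (0 : ℝ) < (n : ℝ) ^ (d + 1) := pow_pos (Nat.cast_pos.mpr (Nat.pos_of_ne_zero (NeZero.ne n))) _
  refine hasMaj_mulVecLin_of_sum_abs_le _ _ (fun w w' => by split_ifs <;> first | positivity | exact mul_nonneg (inv_nonneg.mpr hn.le) (hσ0 _)) fun p w' => ?_
  change ∑ q ∈ fibre (liftBlk (fun y : Tor M => y) ι) w', |(csavg M n T - csavg M n (fun (_ : Fin (d + 1)) (_ : Tor (fine n M)) => (1 : Matrix ι ι ℝ)))ᵀ p q| ≤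
    if blockOf n M p.1 = w' then ((n : ℝ) ^ (d + 1))⁻¹ * σf (blockOf n M p.1) else 0
  simp only [Matrix.transpose_apply]
  split_ifs with hw
  · calc ∑ q ∈ fibre (liftBlk (fun y : Tor M => y) ι) w', |(csavg M n T - csavg M n (fun (_ : Fin (d + 1)) (_ : Tor (fine n M)) => (1 : Matrix ι ι ℝ))) q p|
        ≤ ∑ q, |(csavg M n T - csavg M n (fun (_ : Fin (d + 1)) (_ : Tor (fine n M)) => (1 : Matrix ι ι ℝ))) q p| := Finset.sum_le_univ_sum_of_nonneg fun q => abs_nonneg _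
      _ ≤ ((n : ℝ) ^ (d + 1))⁻¹ * σf (blockOf n M p.1) := csavg_sub_cols_le_at M n (T := T) (T' := fun (_ : Fin (d + 1)) (_ : Tor (fine n M)) => (1 : Matrix ι ι ℝ)) hσ p
  · refine le_of_eq (Finset.sum_eq_zero fun q hq => ?_)
    have hq1 : q.1 = w' := (mem_fibre _ _ _).1 hq
    rw [csavg_sub_apply]
    have : ¬ blockOf n M p.1 = q.1 := fun h => hw (h.trans hq1)
    simp [this]

end LocalLetter

end Summit.QuantumFields.YangMills.BalabanUVNodes.N15.CovLandau

end
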